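import Summits.QuantumFields.BalabanUV.T4Continuum.Support.PerturbationAlgebra

/-!
# T⁴ programme, spine node NE2 (U1a) — BAŁABAN's OWN (1.18) AVERAGING IN THE PERTURBED TOWER: the pairing defect
# `F = √(L^d)·Q_L(Lavg − 1)J` of the line-block average against King's pairing costs one derivative, `‖F𝒢‖ ≤ dL·Cst·η`, so the
# perturbed η-rate holds for `QB`-sandwiched covariances (the lineage's `unitCovB` carriers) as well

Ninth generation of the NE2 prover lineage P1 of the cell `pub-balaban`, file 10.  Files 3–9 used KING's block averaging `Q_L` on the
outside, for which the pairing with `J = L^{d/2}Q_Lᴴ` is exact (`F = 0`).  Generation 8's headline objects (`unitCovB`, `UnitLayer`) are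
sandwiched by BAŁABAN's (1.11)/(1.18) averaging `QB = Q_L·Lavg` (`Support/BalabanLineAverage`), whose pairing with `J` is NOT exact:
`√(L^d)·QB·J = 1 + F`, `F := √(L^d)·Q_L(Lavg − 1)J` (`FQB`).  The abstract sandwich law of file 1 carries exactly this slot; here it is
filled:

 * §1 **`opNorm_Lavg_sub_one_mul_planted_le`**: `‖(Lavg − 1)·(J𝒢Jᴴ)‖ ≤ dR·Cst·η` — gen 8's smoothing lemma
   `BalabanLineAverage.opNorm_Lavg_sub_one_mul_le` (`Lavg − 1` costs one FINE derivative) fed with file 6's `∇′J = R·FJ∇` and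
   (1.89) `‖∇𝒢‖ ≤ Cst`; hence **`opNorm_FQB_mul_calG_le`** `‖F𝒢‖ ≤ dR·Cst·η` and `‖𝒢Fᴴ‖ ≤ dR·Cst·η`; `sqrt_smul_QB_mul_JK` (the
   pairing identity).
 * §2 **`freeTowerLaws_balaban : FreeTowerLaws (calDalev L M a ha) (QBlev L M) (JpcT L M) (FQBlev L M) (L^d) (2dCst·L^{−k}) (CJ·L^{−k})
   (dLCst·L^{−k})`** — the `U = 1` bundle for Bałaban's averaging is a THEOREM; **`towerLimitRate_perturbed_balaban`**: for every
   `PerturbationLaws` family and `‖t‖κ < 1`, the `QB`-sandwiched unit-lattice covariance of `(Δ_a^{(k)} + tP_k)⁻¹` converges with rate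
   `L^{−k}`, constant `Cpert κ (2dCst) CJ C₂ (dLCst) t`; **`towerLimitRate_minimalCoupling_balaban`** (the model of files 7–8).

HONEST FRAMING (T4-DAG p. 1).  `U = 1` averaging (Bałaban's own), background as a perturbation family / minimal-coupling MODEL in a
global small gauge; finite torus, linear layer, operator norm; rates / pairing / constants OURS; NOT infinite volume / mass gap / Clay /
summit progress; spine 0/9 unchanged.  HONEST DEPENDENCY: continuum YM on T⁴ ⇐ BetaPertH ∧ nine spine estimates (0/9 proved);
BetaPertH ⇐ (D1) ∧ (D4) ∧ CAP+tail; G-an2-4 gates asym, D1 and NE2/3/4.  ABSOLUTE RULE kept; no `sorry`.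
-/

noncomputable section

open scoped BigOperators ComplexConjugate Matrix Matrix.Norms.L2Operator
open Filter Topology

namespace Summit.QuantumFields.BalabanUV.T4Continuum.BalabanAveragingPairing

open Literature.MathematicalPhysics.QuantumFieldTheory.Balaban1983to89.B5Prop11Plancherel
open Literature.MathematicalPhysics.QuantumFieldTheory.Balaban1983to89.B5G183RateTorusW
open Literature.MathematicalPhysics.QuantumFieldTheory.Balaban1983to89.B5G183RateUnitTower (lev lev_neZero)
open Summit.QuantumFields.BalabanUV.T4Continuum
open Summit.QuantumFields.BalabanUV.T4Continuum.CovariantAveragingTower (TowerLimitRate)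
open Summit.QuantumFields.BalabanUV.T4Continuum.BalabanLineAverage (Lavg QB opNorm_Lavg_sub_one_mul_le)
open Summit.QuantumFields.BalabanUV.T4Continuum.BalabanAveragedTowerUnit (idx QBlev Qlev calGlev one_le_lev' cast_lev'
  opNorm_QBlev_sq_le)
open Summit.QuantumFields.BalabanUV.T4Continuum.BackgroundResolventTower
open Summit.QuantumFields.BalabanUV.T4Continuum.KingPairingPlantedLaw
open Summit.QuantumFields.BalabanUV.T4Continuum.BlockPairingGeometry
open Summit.QuantumFields.BalabanUV.T4Continuum.BlockPairingFaces
open Summit.QuantumFields.BalabanUV.T4Continuum.NE2PerturbedLayer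
open Summit.QuantumFields.BalabanUV.T4Continuum.FirstOrderBackgroundModel
open Summit.QuantumFields.BalabanUV.T4Continuum.PerturbationAlgebra

variable {d : ℕ}

/-! ## §1 The pairing defect of Bałaban's averaging and its one-derivative cost -/

section TwoLevel

variable (N R : ℕ) [NeZero N] [NeZero R] (M : Fin d → ℕ) [hM : ∀ μ, NeZero (M μ)] (a : ℝ) (ha : 0 < a)

/-- fine derivatives of the planted coarse propagator: `‖∇′_μ·(J𝒢Jᴴ)‖ ≤ R·Cst` (`∇′J = R·FJ∇`, (1.89)). [cite: Balaban1984PropagatorsI,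
Prop. 1.1 (1.89) p.33] [folklore] -/
theorem opNorm_fdiff_planted_le (hN : 1 ≤ N) (μ : Fin d) :
    ‖fdiff (fine (R * N) M) (((R * N : ℕ)) : ℂ) μ * (JK N R M * calG N hN M a ha * (JK N R M)ᴴ)‖ ≤ R * Cst d a := by
  have hC := Cst_nonneg d a
  have e : fdiff (fine (R * N) M) (((R * N : ℕ)) : ℂ) μ * (JK N R M * calG N hN M a ha * (JK N R M)ᴴ)
      = ((R : ℂ)) • ((faceF N R M μ * JK N R M) * (fdiff (fine N M) ((N : ℕ) : ℂ) μ * calG N hN M a ha) * (JK N R M)ᴴ) := by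
    rw [← Matrix.mul_assoc, ← Matrix.mul_assoc, fdiff_mul_JK N R M hN μ, Matrix.smul_mul, Matrix.smul_mul]
    simp only [Matrix.mul_assoc]
  rw [e, norm_smul, Complex.norm_natCast]
  refine mul_le_mul_of_nonneg_left ?_ (Nat.cast_nonneg R)
  have hFJ : ‖faceF N R M μ * JK N R M‖ ≤ 1 :=
    (Matrix.l2_opNorm_mul _ _).trans ((mul_le_mul (opNorm_faceF_le N R M μ) (opNorm_JK_le N R M) (norm_nonneg _) zero_le_one).trans
      (le_of_eq (one_mul 1)))
  have hJ' : ‖(JK N R M)ᴴ‖ ≤ 1 := by rw [Matrix.l2_opNorm_conjTranspose]; exact opNorm_JK_le N R M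
  calc _ ≤ ‖faceF N R M μ * JK N R M * (fdiff (fine N M) ((N : ℕ) : ℂ) μ * calG N hN M a ha)‖ * ‖(JK N R M)ᴴ‖ :=
        Matrix.l2_opNorm_mul _ _
    _ ≤ (1 * Cst d a) * 1 := by
        refine mul_le_mul ((Matrix.l2_opNorm_mul _ _).trans (mul_le_mul hFJ (opNorm_fdiff_calG_le N hN M a ha μ) (norm_nonneg _)
          zero_le_one)) hJ' (norm_nonneg _) (by positivity)
    _ = Cst d a := by ring

/-- **`‖(Lavg − 1)·(J𝒢Jᴴ)‖ ≤ dR·Cst·η`**: the contour average of the planted propagator moves it by `O(η)` — gen 8's smoothing lemma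
with the fine-derivative bound above. [cite: Balaban1984PropagatorsI, (1.11) p.19, (1.18) p.20, Prop. 1.1 (1.89) p.33] [folklore] -/
theorem opNorm_Lavg_sub_one_mul_planted_le (hN : 1 ≤ N) (hRN : 1 ≤ R * N) :
    ‖(Lavg (fine (R * N) M) R - 1) * (JK N R M * calG N hN M a ha * (JK N R M)ᴴ)‖ ≤ d * R * Cst d a / N := by
  have hc : (((R * N : ℕ)) : ℂ) ≠ 0 := by exact_mod_cast (Nat.pos_iff_ne_zero.mp hRN)
  have hcn : ‖(((R * N : ℕ)) : ℂ)‖ = (R : ℝ) * N := by rw [Complex.norm_natCast]; push_cast; ring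
  have hNpos : (0 : ℝ) < N := by exact_mod_cast hN
  have hRpos : (0 : ℝ) < R := by exact_mod_cast Nat.pos_of_ne_zero (NeZero.ne R)
  have h := opNorm_Lavg_sub_one_mul_le (fine (R * N) M) R (JK N R M * calG N hN M a ha * (JK N R M)ᴴ) hc
    (opNorm_fdiff_planted_le N R M a ha hN)
  rw [hcn] at h
  refine h.trans (le_of_eq ?_)
  field_simp

/-- **THE PAIRING DEFECT of Bałaban's averaging** against King's pairing: `F := √(R^d)·Q_R(Lavg − 1)J_R`. [folklore] -/
def FQB : Matrix (Tor (fine N M) × Fin d) (Tor (fine N M) × Fin d) ℂ :=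
  (((Real.sqrt ((R : ℝ) ^ d)) : ℝ) : ℂ) • (Qavg N R M * (Lavg (fine (R * N) M) R - 1) * JK N R M)

/-- **the pairing identity** `√(R^d)·QB·J = 1 + F`. [cite: Balaban1984PropagatorsI, (1.11) p.19, (1.18) p.20; King1986, p.664]
[folklore] -/
theorem sqrt_smul_QB_mul_JK : ((((Real.sqrt ((R : ℝ) ^ d)) : ℝ) : ℂ)) • (QB N R M * JK N R M) = 1 + FQB N R M := by
  rw [FQB, QB, ← sqrt_smul_Qavg_mul_JK N R M, ← smul_add]
  congr 1
  rw [Matrix.mul_sub, Matrix.sub_mul, Matrix.mul_one, Matrix.mul_assoc]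
  abel

/-- **`‖F𝒢‖ ≤ dR·Cst·η`**. [cite: Balaban1984PropagatorsI, Prop. 1.1 (1.89) p.33] [folklore] -/
theorem opNorm_FQB_mul_calG_le (hN : 1 ≤ N) (hRN : 1 ≤ R * N) : ‖FQB N R M * calG N hN M a ha‖ ≤ d * R * Cst d a / N := by
  have hRd : (0 : ℝ) < (R : ℝ) ^ d := pow_pos (by exact_mod_cast Nat.pos_of_ne_zero (NeZero.ne R)) d
  have hs0 : 0 < Real.sqrt ((R : ℝ) ^ d) := Real.sqrt_pos.mpr hRd
  -- `F𝒢 = √(R^d) Q (Lavg − 1)(J𝒢Jᴴ) J`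
  have e : FQB N R M * calG N hN M a ha
      = (((Real.sqrt ((R : ℝ) ^ d)) : ℝ) : ℂ) • (Qavg N R M * ((Lavg (fine (R * N) M) R - 1)
          * (JK N R M * calG N hN M a ha * (JK N R M)ᴴ)) * JK N R M) := by
    rw [FQB, Matrix.smul_mul]
    congr 1
    have hJJ : JK N R M * calG N hN M a ha * (JK N R M)ᴴ * JK N R M = JK N R M * calG N hN M a ha := by
      rw [Matrix.mul_assoc (JK N R M * calG N hN M a ha), JK_conjTranspose_mul_JK, Matrix.mul_one]
    calc Qavg N R M * (Lavg (fine (R * N) M) R - 1) * JK N R M * calG N hN M a ha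
        = Qavg N R M * (Lavg (fine (R * N) M) R - 1) * (JK N R M * calG N hN M a ha) := by simp only [Matrix.mul_assoc]
      _ = Qavg N R M * (Lavg (fine (R * N) M) R - 1) * (JK N R M * calG N hN M a ha * (JK N R M)ᴴ * JK N R M) := by rw [hJJ]
      _ = _ := by simp only [Matrix.mul_assoc]
  rw [e, norm_smul, Complex.norm_real, Real.norm_of_nonneg hs0.le]
  have h1 := opNorm_Lavg_sub_one_mul_planted_le N R M a ha hN hRN
  have h0 : 0 ≤ d * R * Cst d a / N := (norm_nonneg _).trans h1
  calc Real.sqrt ((R : ℝ) ^ d) * ‖Qavg N R M * ((Lavg (fine (R * N) M) R - 1) * (JK N R M * calG N hN M a ha * (JK N R M)ᴴ))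
          * JK N R M‖
      ≤ Real.sqrt ((R : ℝ) ^ d) * (‖Qavg N R M‖ * (d * R * Cst d a / N) * 1) := by
        refine mul_le_mul_of_nonneg_left ?_ hs0.le
        calc _ ≤ ‖Qavg N R M * ((Lavg (fine (R * N) M) R - 1) * (JK N R M * calG N hN M a ha * (JK N R M)ᴴ))‖ * ‖JK N R M‖ :=
              Matrix.l2_opNorm_mul _ _
          _ ≤ ‖Qavg N R M‖ * (d * R * Cst d a / N) * 1 :=
              mul_le_mul ((Matrix.l2_opNorm_mul _ _).trans (mul_le_mul_of_nonneg_left h1 (norm_nonneg _))) (opNorm_JK_le N R M)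
                (norm_nonneg _) (mul_nonneg (norm_nonneg _) h0)
    _ ≤ Real.sqrt ((R : ℝ) ^ d) * ((Real.sqrt ((R : ℝ) ^ d))⁻¹ * (d * R * Cst d a / N) * 1) := by
        refine mul_le_mul_of_nonneg_left ?_ hs0.le
        exact mul_le_mul_of_nonneg_right (mul_le_mul_of_nonneg_right (opNorm_Qavg_le N R M) h0) zero_le_one
    _ = d * R * Cst d a / N := by field_simp

/-- `‖𝒢Fᴴ‖ ≤ dR·Cst·η` (`𝒢` Hermitian: `𝒢Fᴴ = (F𝒢)ᴴ`). [folklore] -/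
theorem opNorm_calG_mul_FQB_conjTranspose_le (hN : 1 ≤ N) (hRN : 1 ≤ R * N) :
    ‖calG N hN M a ha * (FQB N R M)ᴴ‖ ≤ d * R * Cst d a / N := by
  have e : calG N hN M a ha * (FQB N R M)ᴴ = (FQB N R M * calG N hN M a ha)ᴴ := by
    rw [Matrix.conjTranspose_mul, (calG_isHermitian N hN M a ha).eq]
  rw [e, Matrix.l2_opNorm_conjTranspose]
  exact opNorm_FQB_mul_calG_le N R M a ha hN hRN

end TwoLevel

/-! ## §2 The perturbed tower with Bałaban's averaging -/

section Tower

variable (L : ℕ) [NeZero L] (M : Fin d → ℕ) [hM : ∀ μ, NeZero (M μ)] (a : ℝ) (ha : 0 < a)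

/-- the pairing defects along the tower. [folklore] -/
def FQBlev (k : ℕ) : Matrix (idx L M k) (idx L M k) ℂ := FQB (lev L k) L M

/-- **`FreeTowerLaws` FOR BAŁABAN's AVERAGING — A THEOREM**: invertibility, `‖QB‖² ≤ L^{−d}`, `‖J‖ ≤ 1`, the pairing
`√(L^d)·QB·J = 1 + F`, the pairing defects `‖F𝒢‖, ‖𝒢Fᴴ‖ ≤ dLCst·L^{−k}`, the complement and injected defects of file 3.
[cite: Balaban1984PropagatorsI, (1.18) p.20, Prop. 1.1 (1.89) p.33; King1986, p.664, Lemma 4.5 (4.38) p.674] [folklore] -/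
theorem freeTowerLaws_balaban :
    FreeTowerLaws (calDalev L M a ha) (QBlev L M) (JpcT L M) (FQBlev L M) ((L : ℝ) ^ d)
      (fun k => 2 * d * Cst d a * ((L : ℝ)⁻¹) ^ k) (fun k => CJ d a * ((L : ℝ)⁻¹) ^ k)
      (fun k => d * L * Cst d a * ((L : ℝ)⁻¹) ^ k) where
  isUnit_det := isUnit_det_calDalev L M a ha
  opNorm_A_sq_le := opNorm_QBlev_sq_le L M
  opNorm_J_le := opNorm_JpcT_le L M
  A_mul_J := fun k => sqrt_smul_QB_mul_JK (lev L k) L M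
  opNorm_F_mul_inv_le := fun k => by
    have h := opNorm_FQB_mul_calG_le (lev L k) L M a ha (one_le_lev' L k) (one_le_lev' L (k + 1))
    rw [cast_lev'] at h
    rw [calDalev_inv, inv_pow, ← div_eq_mul_inv]
    exact h
  opNorm_inv_mul_F_le := fun k => by
    have h := opNorm_calG_mul_FQB_conjTranspose_le (lev L k) L M a ha (one_le_lev' L k) (one_le_lev' L (k + 1))
    rw [cast_lev'] at h
    rw [calDalev_inv, inv_pow, ← div_eq_mul_inv]
    exact h
  complement_le := complement_le_lev L M a ha
  injected_le := injected_le_lev L M a ha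

/-- **THE PERTURBED η-RATE WITH BAŁABAN's AVERAGING** (`L ≥ 2`): for every perturbation family with `PerturbationLaws … κ (C₂L^{−k})`
and every `‖t‖κ < 1`, the `QB`-sandwiched unit-lattice covariances `(L^d)^k·QB^{(k)}(Δ_a^{(k)} + tP_k)⁻¹QB^{(k)ᴴ}` (at `t = 0`: the
lineage's `unitCovB`) CONVERGE with `‖c_k(t) − c_∞(t)‖ ≤ Cpert(t)·L^{−k}/(1 − L^{−1})`,
`Cpert(t) = (CJ + ‖t‖C₂)(1 − ‖t‖κ)^{−2} + (2dCst + 2dLCst)(1 − ‖t‖κ)^{−1}`. [cite: King1986, Lemma 4.5 (4.32)/(4.38) p.674;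
Balaban1984PropagatorsI, (1.18) p.20, Prop. 1.1 (1.89) p.33] [folklore] -/
theorem towerLimitRate_perturbed_balaban (hL : 2 ≤ L) {P : (k : ℕ) → Matrix (idx L M k) (idx L M k) ℂ} {κ C₂ : ℝ}
    (hpert : PerturbationLaws (calDalev L M a ha) P (JpcT L M) κ (fun k => C₂ * ((L : ℝ)⁻¹) ^ k)) {t : ℂ} (ht : ‖t‖ * κ < 1) :
    TowerLimitRate (QBlev L M) ((L : ℝ) ^ d) (fun k => (calDalev L M a ha k + t • P k)⁻¹)
      (Cpert κ (2 * d * Cst d a) (CJ d a) C₂ (d * L * Cst d a) t) ((L : ℝ)⁻¹) := by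
  have hL1 : (1 : ℝ) < L := by exact_mod_cast (lt_of_lt_of_le one_lt_two hL : 1 < L)
  have hr : (0 : ℝ) < (L : ℝ) ^ d := pow_pos (lt_trans zero_lt_one hL1) d
  exact towerLimitRate_perturbed hr (freeTowerLaws_balaban L M a ha) hpert (inv_lt_one_of_one_lt₀ hL1)
    (fun k => le_rfl) (fun k => le_rfl) (fun k => le_rfl) (fun k => le_rfl) ht

/-- **… for the minimal-coupling model** (`L ≥ 2`, `d ≥ 1`): Lipschitz first-order background `𝒜`, bounded consistent potential `W`,
`‖t‖·((d(α + β) + α′)Cst) < 1`.  NO typed residual. [folklore] -/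
theorem towerLimitRate_minimalCoupling_balaban (hL : 2 ≤ L) (hd : 1 ≤ d) {V : (k : ℕ) → Fin d → (idx L M k → ℂ)}
    {W : (k : ℕ) → (idx L M k → ℂ)} {α β α' β' : ℝ} (hV : LipschitzBackground L M V α β) (hW : BoundedBackground L M W α' β')
    {t : ℂ} (ht : ‖t‖ * kappaMC d a α β α' < 1) :
    TowerLimitRate (QBlev L M) ((L : ℝ) ^ d) (fun k => (calDalev L M a ha k + t • Pmc L M V W k)⁻¹)
      (Cpert (kappaMC d a α β α') (2 * d * Cst d a) (CJ d a) (C2MC d L a α β β') (d * L * Cst d a) t) ((L : ℝ)⁻¹) :=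
  towerLimitRate_perturbed_balaban L M a ha hL (perturbationLaws_minimalCoupling L M a ha hd hV hW) ht

end Tower

end Summit.QuantumFields.BalabanUV.T4Continuum.BalabanAveragingPairing

end
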